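import Summits.ResolutionOfSingularities.ResolutionOfSingularities.Theorems.PurelyInseparableDim4E2NearPresentation
import Summits.ResolutionOfSingularities.ResolutionOfSingularities.Theorems.HilbertSamuelEliminationSigmaMaxModificationsCorridor3WLadderE1TangentConeTransport
import Summits.ResolutionOfSingularities.ResolutionOfSingularities.Theorems.FrobeniusClosingSteerInitialFormOfCongruence
import Summits.ResolutionOfSingularities.ResolutionOfSingularities.Theorems.PurelyInseparableDim4Directrix
import Literature.RingTheory.HilbertSamuel.TangentConeChangeOfGenerators
import Literature.RingTheory.HilbertSamuel.DirectrixQuasiEtale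
import Literature.AlgebraicGeometry.Resolution.DirectrixScheme
import HarnessLib

/-!
# Sub-row (E) «DIRECTRIX» of the E2(3,3) dictionary, STALK HALF: the tangent cone of a point presented by
# `𝒪_{𝔸⁵,0}/(z^p + F)` is the cone `z^p + in_p F`, so `e` and `ē` are directrix dimensions of that ONE form
(cell `res-dim4-pi`, desk WORD #52 (c); row (E) `E2OfCJS.DirectrixRow` of seat p-2 g2's `…E2OfCJSRows`; split with seat
p-5 g2, who supplies the POLYNOMIAL half `directrixDim (Ideal.span {hyp p Φ}) = dim_k A(Φ)` in `…RidgeDirectrix`)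

[OURS · counted 0 · a presentation computation over TREE theorems (W4.2 `E1Free.exists_tangentConeIdeal_eq_map_span_singleton`
= LEMMA T and `spanFinrank_maximalIdeal_eq_of_presentation`; `dirDim_eq'` / `dirDimOver_eq'` of
`Literature…TangentConeChangeOfGenerators`; `NearPoint.mem_initialFormsOf_of_sub_eval_mem`; W4.6 `CampaignW46.AffineFermat.*`
for the stalk of `𝔸⁵` at the origin; this seat's (N) file p664524); nothing here is a statement of any manuscript and nothing
here proves row (E), E2(3,3), `NoIsolatedTrap 3 3` or resolution of singularities in dimension ≥ 4 / characteristic `p`.]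

For a prime `p`, a field `L` of characteristic `p`, `F ∈ L[x₁..x₄]` with `ord₀ F = p`, and a point `x` of a locally
Noetherian scheme `X` with `𝒪_{X,x} ≅ 𝒪_{𝔸⁵_L,ξ} ⧸ stalkIdeal (hypSheaf p F) ξ`:
* §1 `residue_algebraMap_stalk_origin_bijective` — the origin is `L`-rational: `L → κ(𝒪_{𝔸⁵,ξ})` is bijective.
* §2 `hyp_sub_hyp`, `rename_sub_initialForm_mem_pow`, `map_hyp_initialForm_mem_initialFormsOf` — the INITIAL FORM of the
  germ of `z^p + F` in the regular parameters `(z, x₁, …, x₄)` of `𝒪_{𝔸⁵,ξ}` is (the reduction of) `z^p + in_p F`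
  (`= hyp p (initialForm F)`): `z^p + F − (z^p + in_p F) = F − in_p F ∈ 𝔪₀^{p+1}`.
* §3 **`exists_directrix_presentation`** — there is a BIJECTIVE `θ : L → κ(𝒪_{X,x})` with
  `Scheme.dirDim X x = directrixDim (Ideal.span {map θ (hyp p (initialForm F))})` and
  `Scheme.geomDirDim X x = directrixDim (Ideal.span {map (ῑ ∘ θ) (hyp p (initialForm F))})`, `ῑ : κ → κ̄` the algebraic
  closure: `e_x(X)` and `ē_x(X)` ARE the CJS directrix dimensions of the cone `z^p + in_p F` read over `κ(x) ≅ L` resp. `κ̄`.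
  Row (E) then follows from the polynomial identity `directrixDim (Ideal.span {hyp p Φ}) = dim A(Φ)` over a perfect field
  (seat p-5 g2) and base change of `dim A(Φ)`.

bears_on: LADDER-RESOLUTION:D157-DOOR2 (res-dim4-pi · F4-I(3,3) · E2 dictionary row (E), stalk half).  Seat res-dim4-p-1 g2.
Supports stmt-ResolutionOfSingularities-16155 (helper).
-/

set_option linter.dupNamespace false

noncomputable section

open CategoryTheory AlgebraicGeometry IsLocalRing MvPolynomial
open Literature.AlgebraicGeometry.Resolution Scheme.IdealSheafData
open Literature.AlgebraicGeometry.Resolution.Hauser2010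
open Literature.AlgebraicGeometry.Resolution.HauserPerlega2019
open Literature.AlgebraicGeometry.Hironaka2017.SpecOrders
open Literature.RingTheory.HilbertSamuel Literature.RingTheory.MvPolynomial

namespace Summit.ResolutionOfSingularities.ResolutionOfSingularities.Theorems.PIDim4

namespace E2Directrix

open AffinePointBlowup (P ξ A)
open Summit.ResolutionOfSingularities.ResolutionOfSingularities.Theorems.SigmaMaxModificationsCorridor3
open Summit.ResolutionOfSingularities.ResolutionOfSingularities.Theorems.SwitchingDichotomy

variable {L : Type} [Field L]

/-! ## 1. The origin of `𝔸⁵_L` is a rational point -/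

/-- A polynomial minus its constant lies in the ideal of the origin. [folklore] -/
theorem sub_C_constantCoeff_mem_asIdeal_ξ (q : A 4 L) : q - C (constantCoeff q) ∈ (ξ 4 L).asIdeal := by
  change q - C (constantCoeff q) ∈ Literature.AlgebraicGeometry.Resolution.originIdeal L (4 + 1)
  rw [Literature.AlgebraicGeometry.Resolution.mem_originIdeal_iff, map_sub, constantCoeff_C, sub_self]

/-- The residue of the germ of a polynomial at the origin is the residue of (the germ of) its constant term. [folklore] -/
theorem residue_algebraMap_eq_residue_C (q : A 4 L) :
    residue ((P 4 L).presheaf.stalk (ξ 4 L)) (algebraMap (A 4 L) (St (A 4 L) (ξ 4 L)) q) =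
      residue ((P 4 L).presheaf.stalk (ξ 4 L)) (algebraMap (A 4 L) (St (A 4 L) (ξ 4 L)) (C (constantCoeff q))) := by
  rw [← sub_eq_zero, ← map_sub, residue_eq_zero_iff, ← map_sub, maximalIdeal_St]
  exact Ideal.mem_map_of_mem _ (sub_C_constantCoeff_mem_asIdeal_ξ q)

/-- **The origin of `𝔸⁵_L` is `L`-rational**: `L → 𝒪_{𝔸⁵,ξ} → κ(ξ)` is bijective. [cite: GortzWedhorn2020, Prop. 3.8] -/
theorem residue_algebraMap_stalk_origin_bijective :
    Function.Bijective ((residue ((P 4 L).presheaf.stalk (ξ 4 L))).comp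
      ((algebraMap (A 4 L) (St (A 4 L) (ξ 4 L))).comp (C : L →+* A 4 L))) := by
  set θ₀ : L →+* ResidueField ((P 4 L).presheaf.stalk (ξ 4 L)) :=
    (residue ((P 4 L).presheaf.stalk (ξ 4 L))).comp ((algebraMap (A 4 L) (St (A 4 L) (ξ 4 L))).comp C) with hθ₀
  refine ⟨θ₀.injective, fun z => ?_⟩
  obtain ⟨r, rfl⟩ := residue_surjective z
  obtain ⟨⟨a, s⟩, hrs⟩ := IsLocalization.surj (ξ 4 L).asIdeal.primeCompl r
  have hs : constantCoeff (s : A 4 L) ≠ 0 := fun h => s.2 (by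
    change (s : A 4 L) ∈ Literature.AlgebraicGeometry.Resolution.originIdeal L (4 + 1)
    exact (Literature.AlgebraicGeometry.Resolution.mem_originIdeal_iff L (4 + 1)).mpr h)
  have h2 := congrArg (residue ((P 4 L).presheaf.stalk (ξ 4 L))) hrs
  simp only [map_mul] at h2
  rw [residue_algebraMap_eq_residue_C (s : A 4 L), residue_algebraMap_eq_residue_C a] at h2
  change residue _ r * θ₀ (constantCoeff (s : A 4 L)) = θ₀ (constantCoeff a) at h2
  refine ⟨constantCoeff a / constantCoeff (s : A 4 L), ?_⟩
  rw [map_div₀, div_eq_iff ((map_ne_zero θ₀).mpr hs)]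
  exact h2.symm

/-! ## 2. The initial form of the germ of `z^p + F` -/

/-- `(z^p + F) − (z^p + G) = F − G` renamed into `L[z, x]`. [folklore] -/
theorem hyp_sub_hyp (p : ℕ) (F G : MvPolynomial (Fin 4) L) : hyp p F - hyp p G = rename Fin.succ (F - G) := by
  rw [hyp, hyp, map_sub]; ring

/-- `F − in_p F ∈ 𝔪₀^{p+1}` when `ord₀ F = p`, renamed into `L[z, x]` at the origin of `𝔸⁵`. [folklore] -/
theorem rename_sub_initialForm_mem_pow (p : ℕ) (F : MvPolynomial (Fin 4) L) (hF : ordZero F = p) :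
    rename Fin.succ (F - initialForm F) ∈ (ξ 4 L).asIdeal ^ (p + 1) := by
  classical
  change rename Fin.succ (F - initialForm F) ∈ Literature.AlgebraicGeometry.Resolution.originIdeal L (4 + 1) ^ (p + 1)
  have hid : Literature.AlgebraicGeometry.Resolution.originIdeal L (4 + 1) = MvPolynomial.idealOfVars (Fin (4 + 1)) L := by
    ext f
    rw [Literature.AlgebraicGeometry.Resolution.mem_originIdeal_iff,
      Literature.RingTheory.MvPolynomial.mem_idealOfVars_iff_constantCoeff_eq_zero]
  rw [hid, MvPolynomial.mem_pow_idealOfVars_iff']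
  intro d hd
  -- coefficients of `rename succ (F − in F)` in degree `≤ p` vanish
  have hlow : ∀ e : Fin 4 →₀ ℕ, e.degree < p + 1 → coeff e (F - initialForm F) = 0 := by
    intro e he
    rw [coeff_sub, Directrix.initialForm_eq_homogeneousComponent hF, coeff_homogeneousComponent]
    by_cases hep : e.degree = p
    · rw [if_pos hep, sub_self]
    · rw [if_neg hep, sub_zero]
      exact coeff_eq_zero_of_degree_lt_ordZero (by rw [hF]; exact_mod_cast (by omega : e.degree < p))
  by_cases hd0 : d 0 = 0
  · -- `d` comes from `Fin 4`
    obtain ⟨e, rfl⟩ : ∃ e : Fin 4 →₀ ℕ, d = Finsupp.mapDomain Fin.succ e := by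
      refine ⟨Finsupp.comapDomain Fin.succ d (Fin.succ_injective _).injOn, ?_⟩
      ext i
      refine Fin.cases ?_ (fun j => ?_) i
      · rw [hd0, Finsupp.mapDomain_notin_range]
        rintro ⟨j, hj⟩
        exact Fin.succ_ne_zero j hj
      · rw [Finsupp.mapDomain_apply (Fin.succ_injective _), Finsupp.comapDomain_apply]
    rw [coeff_rename_mapDomain _ (Fin.succ_injective _)]
    exact hlow e (by rwa [Finsupp.degree_mapDomain] at hd)
  · exact coeff_rename_eq_zero _ _ _ fun e he => by
      exfalso
      apply hd0
      rw [← he, Finsupp.mapDomain_notin_range]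
      rintro ⟨j, hj⟩
      exact Fin.succ_ne_zero j hj

/-- Evaluating the constant-coefficient extension of a polynomial at the germs of the variables gives the germ of the
polynomial. [folklore] -/
theorem eval_map_algebraMap (H : A 4 L) :
    eval (fun i => algebraMap (A 4 L) (St (A 4 L) (ξ 4 L)) (X i))
        (MvPolynomial.map ((algebraMap (A 4 L) (St (A 4 L) (ξ 4 L))).comp C) H) =
      algebraMap (A 4 L) (St (A 4 L) (ξ 4 L)) H := by
  rw [MvPolynomial.eval_map,
    show (fun i => algebraMap (A 4 L) (St (A 4 L) (ξ 4 L)) (X i)) =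
      ⇑(algebraMap (A 4 L) (St (A 4 L) (ξ 4 L))) ∘ X from rfl,
    ← eval₂_comp_left, eval₂_eta]

/-- **The initial form of the germ of `z^p + F` is `z^p + in_p F`** (in the regular parameters `z, x₁, …, x₄` of
`𝒪_{𝔸⁵,ξ}`, reduced to the residue field). [OURS · row (E) stalk half] [cite: CossartJannsenSaito2020, §2.2 (p. 24)] -/
theorem map_hyp_initialForm_mem_initialFormsOf (p : ℕ) [Fact p.Prime] [CharP L p] (F : MvPolynomial (Fin 4) L)
    (hF : ordZero F = p) :
    MvPolynomial.map (residue ((P 4 L).presheaf.stalk (ξ 4 L)))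
        (MvPolynomial.map ((algebraMap (A 4 L) (St (A 4 L) (ξ 4 L))).comp C) (hyp p (initialForm F))) ∈
      initialFormsOf (fun i => algebraMap (A 4 L) (St (A 4 L) (ξ 4 L)) (X i))
        (algebraMap (A 4 L) (St (A 4 L) (ξ 4 L)) (hyp p F)) p := by
  refine NearPoint.mem_initialFormsOf_of_sub_eval_mem _ (CampaignW46.AffineFermat.maximalIdeal_stalk_origin L 4 rfl).symm
    p _ ?_ _ ?_
  · refine IsHomogeneous.map ?_ _
    rw [hyp]
    exact (by simpa using (isHomogeneous_X L 0).pow p : (X 0 ^ p : MvPolynomial (Fin (4 + 1)) L).IsHomogeneous p).add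
      (Directrix.initialForm_isHomogeneous hF).rename_isHomogeneous
  · rw [eval_map_algebraMap, ← map_sub, hyp_sub_hyp, maximalIdeal_St, ← Ideal.map_pow]
    exact Ideal.mem_map_of_mem _ (rename_sub_initialForm_mem_pow p F hF)

/-! ## 3. `e_x(X)` and `ē_x(X)` are the directrix dimensions of the cone `z^p + in_p F` -/

/-- **Row (E), stalk half.**  Let `p` be prime, `L` a field of characteristic `p`, `F ∈ L[x₁..x₄]` with `ord₀ F = p`, and
`x` a point of a locally Noetherian scheme `X` whose local ring is isomorphic to `𝒪_{𝔸⁵_L,ξ} ⧸ stalkIdeal (hypSheaf p F) ξ`.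
Then along a BIJECTIVE homomorphism `θ : L → κ(x)` (the origin is `L`-rational; LEMMA T of W4.2):
`e_x(X) = e((θ(z^p + in_p F)))` and `ē_x(X) = e((ῑθ(z^p + in_p F)))`, the CJS directrix dimensions
(`Literature.RingTheory.MvPolynomial.directrixDim`) of the principal homogeneous ideal of the cone `z^p + in_p F` over `κ(x)`
resp. over its algebraic closure. [OURS · row (E) stalk half] [cite: CossartJannsenSaito2020, §2.2 (p. 24), Def. 2.18, Def. 2.21] -/
theorem exists_directrix_presentation (p : ℕ) [hp : Fact p.Prime] [CharP L p] (F : MvPolynomial (Fin 4) L)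
    (hF : ordZero F = p) {Y : Scheme.{0}} [IsLocallyNoetherian Y] (y : Y)
    (eX : Y.presheaf.stalk y ≅
      CommRingCat.of ((P 4 L).presheaf.stalk (ξ 4 L) ⧸ stalkIdeal (hypSheaf p F) (ξ 4 L))) :
    ∃ θ : L →+* ResidueField (Y.presheaf.stalk y), Function.Bijective θ ∧
      Scheme.dirDim Y y = directrixDim (Ideal.span {MvPolynomial.map θ (hyp p (initialForm F))}) ∧
      Scheme.geomDirDim Y y = directrixDim (Ideal.span {MvPolynomial.map
        ((algebraMap (ResidueField (Y.presheaf.stalk y))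
          (AlgebraicClosure (ResidueField (Y.presheaf.stalk y)))).comp θ) (hyp p (initialForm F))}) := by
  haveI : IsRegularLocalRing ((P 4 L).presheaf.stalk (ξ 4 L)) := E2Near.isRegularLocalRing_stalk_origin (L := L) p
  -- the presentation `σ : 𝒪_{𝔸⁵,ξ} ↠ 𝒪_{Y,y}` with kernel `(z^p + F)`
  let ε : Y.presheaf.stalk y ≃+* (P 4 L).presheaf.stalk (ξ 4 L) ⧸
      Ideal.span {algebraMap (A 4 L) (St (A 4 L) (ξ 4 L)) (hyp p F)} :=
    eX.commRingCatIsoToRingEquiv.trans (Ideal.quotEquivOfEq (E2Near.stalkIdeal_hypSheaf_origin p F))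
  let σ : (P 4 L).presheaf.stalk (ξ 4 L) →+* Y.presheaf.stalk y :=
    ε.symm.toRingHom.comp (Ideal.Quotient.mk _)
  have hσ : Function.Surjective σ := ε.symm.surjective.comp Ideal.Quotient.mk_surjective
  have hker : RingHom.ker σ = Ideal.span {algebraMap (A 4 L) (St (A 4 L) (ξ 4 L)) (hyp p F)} := by
    ext r
    rw [RingHom.mem_ker, RingHom.comp_apply, RingEquiv.toRingHom_eq_coe, RingEquiv.coe_toRingHom,
      map_eq_zero_iff _ ε.symm.injective, Ideal.Quotient.eq_zero_iff_mem]
  -- the regular parameters `z, x₁, …, x₄`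
  have hy : Ideal.span (Set.range fun i : Fin (4 + 1) => algebraMap (A 4 L) (St (A 4 L) (ξ 4 L)) (X i)) =
      maximalIdeal ((P 4 L).presheaf.stalk (ξ 4 L)) :=
    (CampaignW46.AffineFermat.maximalIdeal_stalk_origin L 4 rfl).symm
  have hd : (maximalIdeal ((P 4 L).presheaf.stalk (ξ 4 L))).spanFinrank = 4 + 1 :=
    CampaignW46.AffineFermat.spanFinrank_maximalIdeal_stalk_origin p L 4 rfl
  have hm := E2Near.germ_hyp_mem_pow p F hF
  have hm' := E2Near.germ_hyp_not_mem_pow_succ p F hF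
  have hIF := map_hyp_initialForm_mem_initialFormsOf p F hF
  have hσy := E1Free.span_range_comp_eq_maximalIdeal hy σ hσ
  obtain ⟨κ, hκ, hJ⟩ := E1Free.exists_tangentConeIdeal_eq_map_span_singleton hd _ hy σ hσ hker hm hm' hIF hσy
  have hdA : (maximalIdeal (Y.presheaf.stalk y)).spanFinrank = 4 + 1 :=
    E1Free.spanFinrank_maximalIdeal_eq_of_presentation hd σ hσ hker hp.out.two_le hm hm' (by norm_num)
  refine ⟨κ.comp ((residue ((P 4 L).presheaf.stalk (ξ 4 L))).comp
      ((algebraMap (A 4 L) (St (A 4 L) (ξ 4 L))).comp C)),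
    hκ.comp residue_algebraMap_stalk_origin_bijective, ?_, ?_⟩
  · show dirDim (Y.presheaf.stalk y) = _
    rw [dirDim_eq' (Y.presheaf.stalk y) hdA _ hσy, hJ, Ideal.map_span, Set.image_singleton,
      MvPolynomial.map_map, MvPolynomial.map_map]
    rfl
  · show dirDimOver (Y.presheaf.stalk y) (AlgebraicClosure (ResidueField (Y.presheaf.stalk y))) = _
    rw [dirDimOver_eq' (Y.presheaf.stalk y) _ hdA _ hσy, hJ, Ideal.map_span, Set.image_singleton, Ideal.map_span,
      Set.image_singleton, MvPolynomial.map_map, MvPolynomial.map_map, MvPolynomial.map_map]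
    rfl

end E2Directrix

end Summit.ResolutionOfSingularities.ResolutionOfSingularities.Theorems.PIDim4

end
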